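import Literature.AlgebraicGeometry.AbelianSchemes.PolarizedAbelianSchemeWithLevelBaseChange
import HarnessLib

/-!
# The type clause and the symplectic-liftability clause are insensitive to nilpotent thickenings of the base

Layer `Literature/AlgebraicGeometry/AbelianSchemes`, namespace `Literature.AlgebraicGeometry.AbelianSchemes.AbelianSchemeOver`.
THEOREMS ONLY (no definition, no named fact, no instance, no `sorry`).  Cell `hodgecm-mathlib` (D-0151), SOCKETS-F §4 (α)
«EQUIDIM BY PROOF», node E5.6 (count-neutral): for a deformation of a polarised abelian scheme with level structure
over an infinitesimal thickening `S₀ ↪ S` of the base, the two PROP-clauses of the moduli object ★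
`PolarizedAbelianSchemeWithLevel` — the type `δ` of the polarisation ([MumfordFogartyKirwan1994] App. 7A, ★
`Polarization.HasType`) and the symplectic-liftability of the level structure ([Lan2013PELCompactifications] Def. 1.3.6.2 /
Lemma 1.3.6.6, ★ `LevelStructure.IsSymplecticLiftable`) — hold over `S` as soon as they hold for the base change to `S₀`.
HC_CM is proved only modulo the 7 printed citations until rung 0 closes.

Both clauses are tested GEOMETRIC POINT BY GEOMETRIC POINT ([Lan2013PELCompactifications] Lemma 1.3.6.6: «it suffices
to verify the statements over each geometric point»), and a geometric point `s : Spec Ω → S` of the thickening factors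
through `S₀` (a surjective closed immersion pulls back to an isomorphism over the reduced scheme `Spec Ω` — Mathlib
`isIso_of_isClosedImmersion_of_surjective`).  At `s = s₀ ≫ i` the fibre of `A ×_S S₀` at `s₀` IS the fibre of `A` at `s`
(★ `fibreBaseChangeIso`), the kernel of `λ̄` on `Ω`-points corresponds (★ `Polarization.mem_kerPointsAt_baseChange_iff`),
an ample witness `Θ` of `λ̄ = Λ(𝒪(Θ))` at `s` pulls back to one at `s₀` (★ `IsLambdaOfAt.baseChange`, ★ `IsAmple.pullback`),
and a symplectic lift transports back along the fibre identification (★ (T1) `SymplecticLift.nonempty_transport`, ★ (T0)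
`SymplecticLift.nonempty_of_linEquiv`).  So this file is the REVERSE companion of ★ `Polarization.HasType.baseChange` /
★ `LevelStructure.IsSymplecticLiftable.of_fibreIso` (which go from `S` to an arbitrary `S′ → S`) for the special
morphisms `S₀ → S` along which geometric points lift.

* §0 geometric points of `S` factor through a surjective closed immersion `i : S₀ → S` (private plumbing).
* §1 `Polarization.HasType.of_baseChange_of_surjective` — `(λ ×_S S₀).HasType δ → λ.HasType δ`; `iff` form
  `Polarization.hasType_baseChange_iff_of_surjective`.
* §2 `LevelStructure.IsSymplecticLiftable.baseChange` — the FORWARD transfer along any `g : S′ → S` packaged (★ (T2)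
  `of_fibreIso` at `fibreBaseChangeIso`, as inside ★ `PolarizedAbelianSchemeWithLevel.baseChange`);
  **`LevelStructure.IsSymplecticLiftable.of_baseChange_of_surjective`** — `(φ ×_S S₀)` symplectic-liftable for `λ ×_S S₀`
  ⇒ `φ` symplectic-liftable for `λ`; `iff` form `LevelStructure.isSymplecticLiftable_baseChange_iff_of_surjective`.

## References
* [Lan2013PELCompactifications] K.-W. Lan, *Arithmetic compactifications of PEL-type Shimura varieties* (2013), §1.3.6
  Def. 1.3.6.2, Lemma 1.3.6.6, Cor. 1.3.6.7 (pp. 80–82).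
* [MumfordFogartyKirwan1994] D. Mumford, J. Fogarty, F. Kirwan, *Geometric Invariant Theory* (3rd ed., 1994), Ch. 7 §2
  Definition 7.2 (p. 129); App. 7A (pp. 234–235).
* [GortzWedhorn2020] U. Görtz, T. Wedhorn, *Algebraic Geometry I* (2nd ed., 2020), Section (4.7) (pp. 107–108).
-/

noncomputable section

universe u

open CategoryTheory CategoryTheory.Limits AlgebraicGeometry

namespace Literature.AlgebraicGeometry.AbelianSchemes

namespace AbelianSchemeOver

open Literature.AlgebraicGeometry.Motives
open scoped MonObj

variable {S₀ S : Scheme.{u}} (A : AbelianSchemeOver S) (i : S₀ ⟶ S) [IsClosedImmersion i] [Surjective i]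

/-! ### §0 Geometric points of `S` factor through the thickening `S₀` -/

/-- A point of `S` with values in a field factors through a surjective closed immersion `i : S₀ → S` (the base change
`Spec Ω ×_S S₀ → Spec Ω` is a surjective closed immersion onto a reduced scheme, hence an isomorphism — Mathlib
`isIso_of_isClosedImmersion_of_surjective`). [cite: GortzWedhorn2020, Section (4.7) (pp. 107–108)] -/
private theorem exists_eq_comp_of_surjective {Ω : Type u} [Field Ω] (s : Spec (.of Ω) ⟶ S) :
    ∃ s₀ : Spec (.of Ω) ⟶ S₀, s = s₀ ≫ i := by
  haveI : IsIso (pullback.fst s i) := isIso_of_isClosedImmersion_of_surjective _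
  exact ⟨inv (pullback.fst s i) ≫ pullback.snd s i, by rw [Category.assoc, ← pullback.condition, IsIso.inv_hom_id_assoc]⟩

/-! ### §1 The type `δ` -/

section HasType

variable (D : A.DualPair) (pol : A.Polarization D) {g : ℕ} {δ : Fin g → ℕ}

/-- **The type clause descends along a surjective closed immersion of the base**: if `λ ×_S S₀` has type `δ` then so has
`λ` — at a geometric point `s = s₀ ≫ i` of `S` the kernel of `λ̄` on `Ω`-points is carried onto the kernel of `λ̄ ×_S S₀`
at `s₀` by the group isomorphism `(A ×_S S₀)_{s₀}(Ω) ≅ A_s(Ω)` (★ `fibrePointsMulEquiv`, ★ `mem_kerPointsAt_baseChange_iff`).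
[cite: MumfordFogartyKirwan1994, App. 7A (pp. 234–235)] [cite: Lan2013PELCompactifications, §1.3.6 Lemma 1.3.6.6 (pp. 81–82)] -/
theorem Polarization.HasType.of_baseChange_of_surjective (h : (pol.baseChange i).HasType δ) : pol.HasType δ := by
  refine ⟨h.1, fun Ω _ _ s => ?_⟩
  obtain ⟨s₀, rfl⟩ := exists_eq_comp_of_surjective i s
  obtain ⟨φ₀, hinj, hrange⟩ := h.2 Ω s₀
  refine ⟨(A.fibrePointsMulEquiv i s₀).toMonoidHom.comp φ₀, (A.fibrePointsMulEquiv i s₀).injective.comp hinj, ?_⟩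
  ext P
  constructor
  · rintro ⟨x, rfl⟩
    have hx : φ₀ x ∈ (pol.baseChange i).kerPointsAt s₀ := hrange ▸ Set.mem_range_self x
    exact (pol.mem_kerPointsAt_baseChange_iff i s₀ (φ₀ x)).1 hx
  · intro hP
    obtain ⟨P', rfl⟩ := (A.fibrePointsMulEquiv i s₀).surjective P
    have hP' : P' ∈ Set.range φ₀ := by
      rw [hrange]
      exact (pol.mem_kerPointsAt_baseChange_iff i s₀ P').2 hP
    obtain ⟨x, rfl⟩ := hP'
    exact ⟨x, rfl⟩

/-- `λ ×_S S₀` has type `δ` iff `λ` has (★ `HasType.baseChange` for the converse).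
[cite: MumfordFogartyKirwan1994, App. 7A (pp. 234–235)] -/
theorem Polarization.hasType_baseChange_iff_of_surjective : (pol.baseChange i).HasType δ ↔ pol.HasType δ :=
  ⟨fun h => Polarization.HasType.of_baseChange_of_surjective A i D pol h, fun h => h.baseChange i⟩

end HasType

/-! ### §2 Symplectic-liftability -/

section Symplectic

variable {D : A.DualPair} (pol : A.Polarization D) {g N : ℕ} (φ : A.LevelStructure g N) (δ : Fin g → ℕ)

omit [IsClosedImmersion i] [Surjective i] in
/-- **FORWARD (any base change)**: `φ` symplectic-liftable for `λ` ⇒ `φ ×_S S′` symplectic-liftable for `λ ×_S S′` — ★ (T2)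
`IsSymplecticLiftable.of_fibreIso` fed with ★ `fibreBaseChangeIso`, ★ `map_fibreBaseChangeIso_restrictPt_baseChange_σ` and
★ `Polarization.transfer_baseChange` (the `symplectic` field of ★ `PolarizedAbelianSchemeWithLevel.baseChange`, as a named
theorem). [cite: Lan2013PELCompactifications, §1.3.6 Lemma 1.3.6.6 and Cor. 1.3.6.7 (pp. 81–82)]
[cite: MumfordFogartyKirwan1994, Ch. 7 §2 Definition 7.2 (p. 129)] -/
theorem LevelStructure.IsSymplecticLiftable.baseChange {S' : Scheme.{u}} (g' : S' ⟶ S)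
    (h : φ.IsSymplecticLiftable pol δ) : (φ.baseChange g').IsSymplecticLiftable (pol.baseChange g') δ :=
  LevelStructure.IsSymplecticLiftable.of_fibreIso g' (fun _ _ _ s' => A.fibreBaseChangeIso g' s')
    (fun _ _ _ s' j => LevelStructure.map_fibreBaseChangeIso_restrictPt_baseChange_σ A g' φ s' j)
    (pol.transfer_baseChange g') h

/-- **The symplectic-liftability clause descends along a surjective closed immersion of the base**: if `φ ×_S S₀` is
symplectic-liftable of type `δ` for `λ ×_S S₀` then `φ` is for `λ`.  At a geometric point `s = s₀ ≫ i` of `S` with an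
ample witness `Θ` of `λ̄ = Λ(𝒪(Θ))`: `e^*Θ` (`e : (A ×_S S₀)_{s₀} ≅ A_s`, ★ `fibreBaseChangeIso`) is an ample witness of
`λ̄ ×_S S₀` at `s₀` (★ `IsLambdaOfAt.baseChange`); lift there by hypothesis; transport the lift back along `e⁻¹` (★ (T1)
`SymplecticLift.nonempty_transport`, sections matched by ★ `map_fibreBaseChangeIso_restrictPt_baseChange_σ`) to a lift for
`(e⁻¹)^*e^*Θ ∼ Θ` (★ (T0) `SymplecticLift.nonempty_of_linEquiv`). [cite: Lan2013PELCompactifications, §1.3.6 Lemma 1.3.6.6 (pp. 81–82)]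
[cite: MumfordFogartyKirwan1994, Ch. 7 §2 Definition 7.2 (p. 129)] -/
theorem LevelStructure.IsSymplecticLiftable.of_baseChange_of_surjective
    (h : (φ.baseChange i).IsSymplecticLiftable (pol.baseChange i) δ) : φ.IsSymplecticLiftable pol δ := by
  intro Ω _ _ s Θ hΘ hlam
  obtain ⟨s₀, rfl⟩ := exists_eq_comp_of_surjective i s
  haveI := A.isIso_toSchemeHom_fibreBaseChangeIso i s₀
  haveI := A.isIso_toSchemeHom_fibreBaseChangeIso_inv i s₀
  haveI hdom := AbelianVariety.isDominant_toSchemeHom_iso_hom (A.fibreBaseChangeIso i s₀).symm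
  -- the witness on the `S₀`-side
  have hΘ₀ : (A.divisorBaseChange i s₀ Θ).IsAmple := hΘ.pullback _
  have hlam₀ : (A.baseChange i).IsLambdaOfAt s₀ (D.baseChange i) (pol.baseChange i).lam (A.divisorBaseChange i s₀ Θ) :=
    IsLambdaOfAt.baseChange A i D s₀ pol.lam Θ hlam
  obtain ⟨Λ₀⟩ := h Ω s₀ _ hΘ₀ hlam₀
  -- transport back along `e⁻¹`
  have he : ∀ j : Fin g ⊕ Fin g,
      AlgPoints.map (A.fibreBaseChangeIso i s₀).symm.hom.hom.hom.hom (A.restrictPt (s₀ ≫ i) (φ.σ j)) =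
        (A.baseChange i).restrictPt s₀ ((φ.baseChange i).σ j) := fun j => by
    rw [← LevelStructure.map_fibreBaseChangeIso_restrictPt_baseChange_σ A i φ s₀ j]
    exact (A.fibrePointsMulEquiv i s₀).symm_apply_apply _
  obtain ⟨Λ⟩ := Λ₀.nonempty_transport (A.fibreBaseChangeIso i s₀).symm he
  -- `(e⁻¹)^* e^* Θ` is the same divisor as `Θ`
  have hsame : ((A.divisorBaseChange i s₀ Θ).pullback
      (AbelianVariety.Hom.toSchemeHom (A.fibreBaseChangeIso i s₀).symm.hom)).SameDivisor Θ :=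
    ((Θ.pullback_pullback_sameDivisor _ _).trans
      (Θ.pullback_congr_sameDivisor (A.toSchemeHom_fibreBaseChangeIso_inv_comp_hom i s₀))).trans
      Θ.pullback_id_sameDivisor
  exact Λ.nonempty_of_linEquiv hsame.linEquiv

/-- `φ ×_S S₀` is symplectic-liftable for `λ ×_S S₀` iff `φ` is for `λ`.
[cite: Lan2013PELCompactifications, §1.3.6 Lemma 1.3.6.6 and Cor. 1.3.6.7 (pp. 81–82)] -/
theorem LevelStructure.isSymplecticLiftable_baseChange_iff_of_surjective :
    (φ.baseChange i).IsSymplecticLiftable (pol.baseChange i) δ ↔ φ.IsSymplecticLiftable pol δ :=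
  ⟨fun h => LevelStructure.IsSymplecticLiftable.of_baseChange_of_surjective A i pol φ δ h,
    fun h => LevelStructure.IsSymplecticLiftable.baseChange A pol φ δ i h⟩

end Symplectic

end AbelianSchemeOver

end Literature.AlgebraicGeometry.AbelianSchemes
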